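import Summits.QuantumFields.BalabanUV.Beta.GAN24.E3UnitSplit
import Summits.QuantumFields.BalabanUV.Beta.GAN24.CombesThomas
import Summits.QuantumFields.BalabanUV.Beta.HessKerDressedUnits
import Literature.MathematicalPhysics.QuantumFieldTheory.Balaban1983to89.Beta.HessKerRate
import Literature.MathematicalPhysics.QuantumFieldTheory.Balaban1983to89.Beta.KernelWard
import Literature.MathematicalPhysics.QuantumFieldTheory.Balaban1983to89.Beta.KernelReflection
import Literature.MathematicalPhysics.QuantumFieldTheory.Balaban1983to89.Beta.DecLiftAdjoint

/-!
# `BalabanUV.Beta.GAN24.ThirdJetKernel` — binder row G-an2-4 / (CONV-C), S-slot («E3Shape» ∧ «E3SupRate»), road S3: THE THIRD-JET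
# FUNCTIONAL THROUGH AN ARBITRARY PACKED KERNEL — shape, Lipschitz and unit calculus (generic engine of the TOP BORDER ROWS Vt ∕ dVt;
# part A of «ROW-dVt*», unit `b2b-balaban-gan24-formalise-leaf-05`, gen 19; part B = `GAN24/TopBorderKSlot`)

NOT IN PRINT; OUR BOOKKEEPING.  HONEST FRAMING (cell contract, verbatim): «discharging `BetaPertH` makes Bałaban's UV stability
UNCONDITIONAL — a real constructive-QFT result; it is NOT the continuum limit and NOT the Clay problem.»  HONEST DEPENDENCY (verbatim):
«continuum YM on T⁴ ⇐ BetaPertH ∧ nine spine estimates (0/9 proved); BetaPertH ⇐ (D1) ∧ (D4) ∧ CAP+tail; G-an2-4 gates asym, D1 and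
NE2/3/4.»  [folklore] kernel calculus over the tree's sockets — `ExpKernelCalculus` (`comp`, `Decays`, `BiLoc`), an2's
`OneStepKernelFamily.vertexOfK` (the chain-rule vertex through an ARBITRARY packed kernel), `BalabanStepJetsSucc.mmRead`, the Lipschitz
bricks of `HessKerRate` / `KernelWard`, the leg units of `HessKerDressedUnits` — BY NAME; generic `d`, generic blocking `L`, kernels
ABSTRACT; ONE plumbing `def` (`e3K`, the functional) and two displayed constants (`e3ShapeConst`, `e3LipConst`); NO estimate about
Bałaban's kernels, NO cited fact, NO `def … : Prop`, NO wall binder; the reserved family `GAN24.StencilSlotE3*` is untouched.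
Discharges NOTHING of «E3Shape»/«E3SupRate»/(hS, hSall); NOT BetaPertH, NOT continuum, NOT Clay.

## Why (the located use; part B proves it)
leaf-01's `E3UnitSplit.e3OfS N S κ′ u′ := −mmRead N (KInv_N ∘ vertexOf_N S κ′ u′ ∘ KInv_N)` hard-wires the one-shot packed resolvent
`KInv (N := N)` into all three legs.  For the TOP border piece `(cVH·M^{d+2}) • borderInc d Lc M` of member `j+1` (`N = Lc^{j+1}`,
`M = Lc^j`) an4's stencil-index swap `DecLiftAdjoint.vertexOf_borderPiece` (I1), an2's sandwich identity
`InterLevelTransport.dec_comp_avgLift_comp` (I2) and `mmRead_eq_dec` (I3) move all three legs onto the DECIMATED step resolvent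
`KInvStep Lc j = dec M (KInv N)` — the K-slot's object.  This file therefore develops the functional with the kernel as a PARAMETER:
`e3K K L S κ′ u′ := −mmRead L (K ∘ vertexOfK K L S κ′ u′ ∘ K)`, `e3OfS N S = e3K (KInv N) N S` (`e3OfS_eq_e3K`).

## What is proved (generic `d`, any `L`; `|F| = 2(d+1)` the fibre cardinality)
§1 `e3K`, `e3OfS_eq_e3K`, block pins, scalar linearity in the table (`e3K_smul`).
§2 SHAPE: `Decays K C δK`, `LocStencil S Cs δ`, `0 < δ ≤ δK`, `1 ≤ L` ⟹ `LocStencil (e3K K L S) (e3ShapeConst d C Cs δ) (δ/8)`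
   (`locStencil_e3K`; the proof of an2's `locStencil_e3Of` with the kernel abstract and the constant displayed:
   `vertexFamily_vertexOfK` → `biLoc_comp_decays` → `biLoc_comp_right` → `biLoc_mmRead`).
§3 LIPSCHITZ IN THE KERNEL: `Decays K C δK`, `Decays K′ C′ δK`, `Decays (K′ − K) ε δK`, same `S` ⟹
   `BiLoc (e3K K′ L S κ′ u′ − e3K K L S κ′ u′) u′ u′ (e3LipConst d C C′ Cs δ · ε) (δ/8)` (`biLoc_e3K_sub`; telescoping
   `K′V′K′ − KVK = (K′V′ − KV)K′ + KV(K′ − K)`, `K′V′ − KV = (K′−K)V′ + K(V′−V)` over `HessKerRate.comp_sub_comp` /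
   `vertexFamily_vertexOfK_sub` / `KernelWard.comp_sub_left/right`) and the sup-norm corollary `supBound_e3K_sub`.
§4 UNITS: `e3K (D K D) L (unitS S) = s_m² · e3K K L S` (`e3K_unit`; `HessKerDressedUnits.vertexOfK_unit`, `HessKerRate.comp_scaleK`).
§5 FAMILIES: for a kernel sequence with `UniformDecays` and `DecayCauchy` data (the K-slot's two predicates, abstractly) the functional is a
   `j`-uniform local stencil family and has the one-step sup rate `e3LipConst·cK·θ^j` (`locStencil_e3K_family`, `supBound_e3K_step`).
-/

noncomputable section

open Finset
open scoped BigOperators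
open Literature.MathematicalPhysics.QuantumFieldTheory
open Literature.MathematicalPhysics.QuantumFieldTheory.Balaban1983to89
open Literature.MathematicalPhysics.QuantumFieldTheory.Balaban1983to89.Beta
open B12Sec2to5 (l1 l1_nonneg)
open ExpKernelCalculus (MKer Decays BiLoc VertexFamily comp Zl Zl_nonneg)
open OneStepResolventKernel (Fib LocStencil KInv decays_mono biLoc_mono)
open OneStepKernelFamily (vertexOfK vertexOfK_KInv vertexFamily_vertexOfK)
open BalabanStepJetsSucc (mmRead mmRead_inl_inl mmRead_inr_left mmRead_inr_right biLoc_mmRead biLoc_comp_right)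
open KernelWard (Bdd bdd_of_decays bdd_of_biLoc biLoc_add comp_sub_left comp_sub_right slices_biLoc_bdd)
open HessKerRate (scaleK comp_scaleK comp_sub_comp biLoc_comp_sub_comp vertexFamily_vertexOfK_sub decays_sub)
open DecLiftAdjoint (vertexOfK_smul)
open Summit.QuantumFields.BalabanUV.Beta.HessKerDressedUnits (legScale unitK unitS counitK vertexOfK_unit legScale_mul_legScale_inv
  legScale_inv_mul_legScale legScale_inr)
open Summit.QuantumFields.BalabanUV.Beta.GAN24.CombesThomas (SupBound UniformDecays DecayCauchy)
open Summit.QuantumFields.BalabanUV.Beta.GAN24.E3UnitSplit (e3OfS)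

namespace Summit.QuantumFields.BalabanUV.Beta.GAN24.ThirdJetKernel

variable {d : ℕ}

/-! ## §1 The third-jet functional through an arbitrary packed kernel -/

/-- [folklore] **THE THIRD-JET FUNCTIONAL THROUGH AN ARBITRARY PACKED KERNEL** `K` at blocking `L`:
`e3K K L S κ′ u′ := −mmRead L (K ∘ vertexOfK K L S κ′ u′ ∘ K)` — leaf-01's `E3UnitSplit.e3OfS N S` is the instance `K = KInv N`,
`L = N` (`e3OfS_eq_e3K`); the top border rows read it at `K = KInvStep Lc j`, `L = Lc` (part B).  A definition asserting nothing. -/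
def e3K (K : MKer (d + 1) (Fib d)) (L : ℕ) (S : Fin (d + 1) → (Fin (d + 1) → ℤ) → MKer (d + 1) (Fib d)) (κ' : Fin (d + 1))
    (u' : Fin (d + 1) → ℤ) : MKer (d + 1) (Fib d) :=
  fun x z a b => -(mmRead L (comp (comp K (vertexOfK K L S κ' u')) K) x z a b)

/-- [folklore] leaf-01's third-jet functional of a stencil family IS `e3K` through the one-shot packed resolvent
(`OneStepKernelFamily.vertexOfK_KInv`). -/
theorem e3OfS_eq_e3K {N : ℕ} [NeZero N] (S : Fin (d + 1) → (Fin (d + 1) → ℤ) → MKer (d + 1) (Fib d)) (κ' : Fin (d + 1))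
    (u' : Fin (d + 1) → ℤ) : e3OfS N S κ' u' = e3K (KInv (N := N) (d := d)) N S κ' u' := by
  funext x z a b
  simp only [e3OfS, e3K, vertexOfK_KInv]

/-- [folklore] The field–field block of `e3K` (the `mm`-block of the sandwich at the dilated points, negated). -/
theorem e3K_inl_inl (K : MKer (d + 1) (Fib d)) (L : ℕ) (S : Fin (d + 1) → (Fin (d + 1) → ℤ) → MKer (d + 1) (Fib d))
    (κ' : Fin (d + 1)) (u' x z : Fin (d + 1) → ℤ) (α β : Fin (d + 1)) :
    e3K K L S κ' u' x z (Sum.inl α) (Sum.inl β) =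
      -(comp (comp K (vertexOfK K L S κ' u')) K ((L : ℤ) • x) ((L : ℤ) • z) (Sum.inr α) (Sum.inr β)) := rfl

/-- [folklore] `e3K` has no multiplier legs (left). -/
@[simp] theorem e3K_inr_left (K : MKer (d + 1) (Fib d)) (L : ℕ) (S : Fin (d + 1) → (Fin (d + 1) → ℤ) → MKer (d + 1) (Fib d))
    (κ' : Fin (d + 1)) (u' x z : Fin (d + 1) → ℤ) (μ : Fin (d + 1)) (b : Fib d) : e3K K L S κ' u' x z (Sum.inr μ) b = 0 := by
  simp only [e3K, mmRead_inr_left, neg_zero]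

/-- [folklore] `e3K` has no multiplier legs (right). -/
@[simp] theorem e3K_inr_right (K : MKer (d + 1) (Fib d)) (L : ℕ) (S : Fin (d + 1) → (Fin (d + 1) → ℤ) → MKer (d + 1) (Fib d))
    (κ' : Fin (d + 1)) (u' x z : Fin (d + 1) → ℤ) (a : Fib d) (ν : Fin (d + 1)) : e3K K L S κ' u' x z a (Sum.inr ν) = 0 := by
  simp only [e3K, mmRead_inr_right, neg_zero]

/-- [folklore] The `mm`-read is linear: scalars. -/
theorem mmRead_smul (L : ℕ) (c : ℝ) (F : MKer (d + 1) (Fib d)) : mmRead L (c • F) = c • mmRead L F := by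
  funext x z a b
  rcases a with α | μ <;> rcases b with β | ν <;> simp [mmRead]

/-- [folklore] The `mm`-read is linear: differences. -/
theorem mmRead_sub (L : ℕ) (F F' : MKer (d + 1) (Fib d)) : mmRead L (F - F') = mmRead L F - mmRead L F' := by
  funext x z a b
  rcases a with α | μ <;> rcases b with β | ν <;> simp [mmRead]

/-- [folklore] **`e3K` IS LINEAR IN THE TABLE**: a scalar weight on the stencil family factors out (`vertexOfK_smul`,
`comp_smul_left/right`; unconditional — `tsum_mul_left` only). -/
theorem e3K_smul (K : MKer (d + 1) (Fib d)) (L : ℕ) (c : ℝ) (S : Fin (d + 1) → (Fin (d + 1) → ℤ) → MKer (d + 1) (Fib d))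
    (κ' : Fin (d + 1)) (u' : Fin (d + 1) → ℤ) :
    e3K K L (fun κ u => c • S κ u) κ' u' = c • e3K K L S κ' u' := by
  funext x z a b
  simp only [e3K, vertexOfK_smul, KernelReflection.comp_smul_right, KernelReflection.comp_smul_left, mmRead_smul, Pi.smul_apply,
    smul_eq_mul, mul_neg]

/-! ## §2 SHAPE: the functional of a decaying kernel and a local table is a local stencil family (constant displayed) -/

/-- [folklore] The SHAPE constant of `locStencil_e3K`: `|F|·((|F|·C·Cv·Zl(δ/4))·C)·Zl(δ/8)`, `Cv = (d+1)·(C·Cs·Zl(δ/2))`,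
`|F| = 2(d+1)` — cubic in the kernel constant `C`, linear in the table constant `Cs`. -/
def e3ShapeConst (d : ℕ) (C Cs δ : ℝ) : ℝ :=
  (Fintype.card (Fib d) : ℝ) * (((Fintype.card (Fib d) : ℝ) * (C * ((d + 1 : ℕ) * (C * Cs * Zl (d + 1) (δ / 2)))) *
    Zl (d + 1) (δ / 2 - δ / 4)) * C) * Zl (d + 1) (δ / 4 - δ / 8)

/-- [folklore] **THE SANDWICH `K ∘ vertexOfK K L S κ′ u′ ∘ K` IS BI-LOCALISED AT THE COARSE BOND** `(L•u′, L•u′)`, rate `δ/8`, with the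
displayed constant (before the `mm`-read). -/
theorem biLoc_sandwich {K : MKer (d + 1) (Fib d)} {C δK : ℝ} (hK : Decays K C δK)
    {S : Fin (d + 1) → (Fin (d + 1) → ℤ) → MKer (d + 1) (Fib d)} {Cs δ : ℝ} (hS : LocStencil S Cs δ) (hδ : 0 < δ) (hδK : δ ≤ δK)
    (L : ℕ) (κ' : Fin (d + 1)) (u' : Fin (d + 1) → ℤ) :
    BiLoc (comp (comp K (vertexOfK K L S κ' u')) K) ((L : ℤ) • u') ((L : ℤ) • u')
      ((Fintype.card (Fib d) : ℝ) * (((Fintype.card (Fib d) : ℝ) * (C * ((d + 1 : ℕ) * (C * Cs * Zl (d + 1) (δ / 2)))) *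
        Zl (d + 1) (δ / 2 - δ / 4)) * C) * Zl (d + 1) (δ / 4 - δ / 8)) (δ / 8) := by
  have hC : 0 ≤ C := hK.nonneg (Sum.inl 0)
  have hV := vertexFamily_vertexOfK (N := L) hK hC hS hδ hδK κ' u'
  have hK2 : Decays K C (δ / 2) := decays_mono hK hC le_rfl (by linarith)
  have hK4 : Decays K C (δ / 4) := decays_mono hK hC le_rfl (by linarith)
  have h1 := ExpKernelCalculus.biLoc_comp_decays hK2 hV (show (0 : ℝ) ≤ δ / 4 by positivity) (by linarith)
  exact biLoc_comp_right h1 hK4 (show (0 : ℝ) ≤ δ / 8 by positivity) (by linarith)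

/-- [folklore] **SHAPE**: for a decaying kernel `K` (constant `C`, rate `δK`) and a local stencil family `S` (constant `Cs`, rate
`0 < δ ≤ δK`), blocking `L ≥ 1`: `e3K K L S` is a local stencil family on the coarse lattice with constant `e3ShapeConst d C Cs δ` and
rate `δ/8` (an2's `locStencil_e3Of`, kernel abstract, constants displayed). -/
theorem locStencil_e3K {K : MKer (d + 1) (Fib d)} {C δK : ℝ} (hK : Decays K C δK)
    {S : Fin (d + 1) → (Fin (d + 1) → ℤ) → MKer (d + 1) (Fib d)} {Cs δ : ℝ} (hS : LocStencil S Cs δ) (hδ : 0 < δ) (hδK : δ ≤ δK)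
    {L : ℕ} (hL : 1 ≤ L) : LocStencil (e3K K L S) (e3ShapeConst d C Cs δ) (δ / 8) := by
  intro κ' u' x z a b
  have h := biLoc_mmRead hL (biLoc_sandwich hK hS hδ hδK L κ' u') (show (0 : ℝ) ≤ δ / 8 by positivity) x z a b
  rw [show e3K K L S κ' u' x z a b = -(mmRead L (comp (comp K (vertexOfK K L S κ' u')) K) x z a b) from rfl, abs_neg]
  exact h

/-- [folklore] The shape constant is nonnegative for nonnegative data. -/
theorem e3ShapeConst_nonneg {C Cs δ : ℝ} (hC : 0 ≤ C) (hCs : 0 ≤ Cs) (hδ : 0 < δ) : 0 ≤ e3ShapeConst d C Cs δ := by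
  unfold e3ShapeConst
  have h1 : 0 ≤ Zl (d + 1) (δ / 2) := Zl_nonneg (by positivity)
  have h2 : 0 ≤ Zl (d + 1) (δ / 2 - δ / 4) := Zl_nonneg (by linarith)
  have h3 : 0 ≤ Zl (d + 1) (δ / 4 - δ / 8) := Zl_nonneg (by linarith)
  positivity

/-! ## §3 LIPSCHITZ in the kernel: the one-step difference of the functional -/

/-- [folklore] The LIPSCHITZ constant of `biLoc_e3K_sub` (per unit of the kernel deviation `ε`):
`|F|·Zl(δ/8)·[(|F|·Cv′·Zl(δ/4) + |F|·C·((d+1)·Cs·Zl(δ/2))·Zl(δ/4))·C′ + |F|·C·Cv·Zl(δ/4)]`, `Cv = (d+1)·C·Cs·Zl(δ/2)`,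
`Cv′ = (d+1)·C′·Cs·Zl(δ/2)`. -/
def e3LipConst (d : ℕ) (C C' Cs δ : ℝ) : ℝ :=
  (Fintype.card (Fib d) : ℝ) * Zl (d + 1) (δ / 4 - δ / 8) *
    (((Fintype.card (Fib d) : ℝ) * ((d + 1 : ℕ) * (C' * Cs * Zl (d + 1) (δ / 2))) * Zl (d + 1) (δ / 2 - δ / 4) +
        (Fintype.card (Fib d) : ℝ) * (C * ((d + 1 : ℕ) * (Cs * Zl (d + 1) (δ / 2)))) * Zl (d + 1) (δ / 2 - δ / 4)) * C' +
      (Fintype.card (Fib d) : ℝ) * (C * ((d + 1 : ℕ) * (C * Cs * Zl (d + 1) (δ / 2)))) * Zl (d + 1) (δ / 2 - δ / 4))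

/-- [folklore] A stencil family minus itself is the zero family: `LocStencil (S − S) 0 δ`. -/
theorem locStencil_sub_self (S : Fin (d + 1) → (Fin (d + 1) → ℤ) → MKer (d + 1) (Fib d)) (δ : ℝ) :
    LocStencil (S - S) 0 δ := by
  intro κ u x z a b
  simp only [Pi.sub_apply, sub_self, abs_zero, zero_mul, le_refl]

/-- [folklore] **TELESCOPING OF THE SANDWICH** (all series absolutely convergent): with `V = vertexOfK K L S κ′ u′`,
`V′ = vertexOfK K′ L S κ′ u′`:  `K′V′K′ − KVK = (K′V′ − KV) ∘ K′ + (KV) ∘ (K′ − K)`. -/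
theorem sandwich_sub {K K' : MKer (d + 1) (Fib d)} {C C' δK : ℝ} (hK : Decays K C δK) (hK' : Decays K' C' δK)
    {S : Fin (d + 1) → (Fin (d + 1) → ℤ) → MKer (d + 1) (Fib d)} {Cs δ : ℝ} (hS : LocStencil S Cs δ) (hδ : 0 < δ) (hδK : δ ≤ δK)
    (L : ℕ) (κ' : Fin (d + 1)) (u' : Fin (d + 1) → ℤ) :
    comp (comp K' (vertexOfK K' L S κ' u')) K' - comp (comp K (vertexOfK K L S κ' u')) K =
      comp (comp K' (vertexOfK K' L S κ' u') - comp K (vertexOfK K L S κ' u')) K' +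
        comp (comp K (vertexOfK K L S κ' u')) (K' - K) := by
  have hC : 0 ≤ C := hK.nonneg (Sum.inl 0)
  have hC' : 0 ≤ C' := hK'.nonneg (Sum.inl 0)
  have hV := vertexFamily_vertexOfK (N := L) hK hC hS hδ hδK κ' u'
  have hV' := vertexFamily_vertexOfK (N := L) hK' hC' hS hδ hδK κ' u'
  have hK2 : Decays K C (δ / 2) := decays_mono hK hC le_rfl (by linarith)
  have hK2' : Decays K' C' (δ / 2) := decays_mono hK' hC' le_rfl (by linarith)
  have hA := ExpKernelCalculus.biLoc_comp_decays hK2 hV (show (0 : ℝ) ≤ δ / 4 by positivity) (by linarith)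
  have hA' := ExpKernelCalculus.biLoc_comp_decays hK2' hV' (show (0 : ℝ) ≤ δ / 4 by positivity) (by linarith)
  have bK : Bdd K C := bdd_of_decays hK (by linarith)
  have bK' : Bdd K' C' := bdd_of_decays hK' (by linarith)
  have hδ4 : (0 : ℝ) < δ / 4 := by positivity
  rw [comp_sub_left (slices_biLoc_bdd hA' bK' hδ4) (slices_biLoc_bdd hA bK' hδ4),
    comp_sub_right (slices_biLoc_bdd hA bK' hδ4) (slices_biLoc_bdd hA bK hδ4)]
  abel

/-- [folklore] **LIPSCHITZ IN THE KERNEL** (same table): `Decays K C δK`, `Decays K′ C′ δK`, `Decays (K′ − K) ε δK`, `LocStencil S Cs δ`,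
`0 < δ ≤ δK` ⟹ the sandwich difference is bi-localised at the coarse bond with constant `e3LipConst d C C′ Cs δ · ε`, rate `δ/8`. -/
theorem biLoc_sandwich_sub {K K' : MKer (d + 1) (Fib d)} {C C' ε δK : ℝ} (hK : Decays K C δK) (hK' : Decays K' C' δK)
    (hKK : Decays (K' - K) ε δK) {S : Fin (d + 1) → (Fin (d + 1) → ℤ) → MKer (d + 1) (Fib d)} {Cs δ : ℝ}
    (hS : LocStencil S Cs δ) (hδ : 0 < δ) (hδK : δ ≤ δK) (L : ℕ) (κ' : Fin (d + 1)) (u' : Fin (d + 1) → ℤ) :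
    BiLoc (comp (comp K' (vertexOfK K' L S κ' u')) K' - comp (comp K (vertexOfK K L S κ' u')) K) ((L : ℤ) • u') ((L : ℤ) • u')
      (e3LipConst d C C' Cs δ * ε) (δ / 8) := by
  have hC : 0 ≤ C := hK.nonneg (Sum.inl 0)
  have hC' : 0 ≤ C' := hK'.nonneg (Sum.inl 0)
  have hε : 0 ≤ ε := hKK.nonneg (Sum.inl 0)
  have hV := vertexFamily_vertexOfK (N := L) hK hC hS hδ hδK κ' u'
  have hV' := vertexFamily_vertexOfK (N := L) hK' hC' hS hδ hδK κ' u'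
  -- the vertex difference (same table: `εS = 0`)
  have hVV : BiLoc (vertexOfK K' L S κ' u' - vertexOfK K L S κ' u') ((L : ℤ) • u') ((L : ℤ) • u')
      ((d + 1 : ℕ) * ((ε * Cs + C * 0) * Zl (d + 1) (δ / 2))) (δ / 2) :=
    (vertexFamily_vertexOfK_sub hK' hK hKK hS hS (locStencil_sub_self S δ) hδ hδK L) κ' u'
  have hK2 : Decays K C (δ / 2) := decays_mono hK hC le_rfl (by linarith)
  have hK2' : Decays K' C' (δ / 2) := decays_mono hK' hC' le_rfl (by linarith)
  have hKK2 : Decays (K' - K) ε (δ / 2) := decays_mono hKK hε le_rfl (by linarith)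
  have hδ2 : (0 : ℝ) < δ / 2 := by positivity
  -- first factor: `K′V′ − KV`, bi-localised at rate δ/4
  have h1 := biLoc_comp_sub_comp hK2' hK2 hKK2 hV' hV hVV hδ2
  have hA := ExpKernelCalculus.biLoc_comp_decays hK2 hV (show (0 : ℝ) ≤ δ / 4 by positivity) (by linarith)
  have hK4 : Decays K C (δ / 4) := decays_mono hK hC le_rfl (by linarith)
  have hK4' : Decays K' C' (δ / 4) := decays_mono hK' hC' le_rfl (by linarith)
  have hKK4 : Decays (K' - K) ε (δ / 4) := decays_mono hKK hε le_rfl (by linarith)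
  have e24 : δ / 2 / 2 = δ / 4 := by ring
  rw [e24] at h1
  have h2 := biLoc_comp_right h1 hK4' (show (0 : ℝ) ≤ δ / 8 by positivity) (by linarith)
  have h3 := biLoc_comp_right hA hKK4 (show (0 : ℝ) ≤ δ / 8 by positivity) (by linarith)
  have h := biLoc_add h2 h3
  rw [sandwich_sub hK hK' hS hδ hδK L κ' u']
  intro x z a b
  refine (h x z a b).trans (le_of_eq ?_)
  simp only [e3LipConst, mul_zero, add_zero]
  ring

/-- [folklore] **`e3K` IS LIPSCHITZ IN THE KERNEL**: under the hypotheses of `biLoc_sandwich_sub` and `1 ≤ L`,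
`BiLoc (e3K K′ L S κ′ u′ − e3K K L S κ′ u′) u′ u′ (e3LipConst d C C′ Cs δ · ε) (δ/8)`. -/
theorem biLoc_e3K_sub {K K' : MKer (d + 1) (Fib d)} {C C' ε δK : ℝ} (hK : Decays K C δK) (hK' : Decays K' C' δK)
    (hKK : Decays (K' - K) ε δK) {S : Fin (d + 1) → (Fin (d + 1) → ℤ) → MKer (d + 1) (Fib d)} {Cs δ : ℝ}
    (hS : LocStencil S Cs δ) (hδ : 0 < δ) (hδK : δ ≤ δK) {L : ℕ} (hL : 1 ≤ L) (κ' : Fin (d + 1)) (u' : Fin (d + 1) → ℤ) :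
    BiLoc (e3K K' L S κ' u' - e3K K L S κ' u') u' u' (e3LipConst d C C' Cs δ * ε) (δ / 8) := by
  have h := biLoc_mmRead hL (biLoc_sandwich_sub hK hK' hKK hS hδ hδK L κ' u') (show (0 : ℝ) ≤ δ / 8 by positivity)
  have e : e3K K' L S κ' u' - e3K K L S κ' u' =
      -(mmRead L (comp (comp K' (vertexOfK K' L S κ' u')) K' - comp (comp K (vertexOfK K L S κ' u')) K)) := by
    funext x z a b
    simp only [e3K, Pi.sub_apply, Pi.neg_apply, mmRead_sub]
    ring
  rw [e]
  intro x z a b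
  simp only [Pi.neg_apply, abs_neg]
  exact h x z a b

/-- [folklore] A kernel bi-localised at rate `≥ 0` is bounded by its constant in the sup norm. -/
theorem supBound_of_biLoc {A : MKer (d + 1) (Fib d)} {p q : Fin (d + 1) → ℤ} {C δ : ℝ} (h : BiLoc A p q C δ) (hδ : 0 ≤ δ) :
    SupBound A C :=
  fun x z a b => bdd_of_biLoc h hδ x z a b

/-- [folklore] **SUP-NORM LIPSCHITZ BOUND**: `SupBound (e3K K′ L S κ′ u′ − e3K K L S κ′ u′) (e3LipConst d C C′ Cs δ · ε)`. -/
theorem supBound_e3K_sub {K K' : MKer (d + 1) (Fib d)} {C C' ε δK : ℝ} (hK : Decays K C δK) (hK' : Decays K' C' δK)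
    (hKK : Decays (K' - K) ε δK) {S : Fin (d + 1) → (Fin (d + 1) → ℤ) → MKer (d + 1) (Fib d)} {Cs δ : ℝ}
    (hS : LocStencil S Cs δ) (hδ : 0 < δ) (hδK : δ ≤ δK) {L : ℕ} (hL : 1 ≤ L) (κ' : Fin (d + 1)) (u' : Fin (d + 1) → ℤ) :
    SupBound (e3K K' L S κ' u' - e3K K L S κ' u') (e3LipConst d C C' Cs δ * ε) :=
  supBound_of_biLoc (biLoc_e3K_sub hK hK' hKK hS hδ hδK hL κ' u') (by positivity)

/-- [folklore] The Lipschitz constant is nonnegative for nonnegative data. -/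
theorem e3LipConst_nonneg {C C' Cs δ : ℝ} (hC : 0 ≤ C) (hC' : 0 ≤ C') (hCs : 0 ≤ Cs) (hδ : 0 < δ) :
    0 ≤ e3LipConst d C C' Cs δ := by
  unfold e3LipConst
  have h1 : 0 ≤ Zl (d + 1) (δ / 2) := Zl_nonneg (by positivity)
  have h2 : 0 ≤ Zl (d + 1) (δ / 2 - δ / 4) := Zl_nonneg (by linarith)
  have h3 : 0 ≤ Zl (d + 1) (δ / 4 - δ / 8) := Zl_nonneg (by linarith)
  positivity

/-! ## §4 UNITS: the functional under the diagonal rescaling of the legs -/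

/-- [folklore] **UNITS COVARIANCE OF THE THIRD-JET FUNCTIONAL**: `e3K (D K D) L (unitS S) κ′ u′ = s_m² · e3K K L S κ′ u′`
(`D = diag(s_f ∣ s_m)`, nonzero units): the stencil table transforms contragrediently (`vertexOfK_unit`), the inner units cancel in the two
compositions (`comp_scaleK`), and the `mm`-read keeps the two outer multiplier units. -/
theorem e3K_unit {sf sm : ℝ} (hsf : sf ≠ 0) (hsm : sm ≠ 0) (K : MKer (d + 1) (Fib d)) (L : ℕ)
    (S : Fin (d + 1) → (Fin (d + 1) → ℤ) → MKer (d + 1) (Fib d)) (κ' : Fin (d + 1)) (u' : Fin (d + 1) → ℤ) :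
    e3K (unitK sf sm K) L (unitS sf sm S) κ' u' = fun x z a b => sm ^ 2 * e3K K L S κ' u' x z a b := by
  have hV : vertexOfK (unitK sf sm K) L (unitS sf sm S) κ' u' = counitK sf sm (vertexOfK K L S κ' u') :=
    vertexOfK_unit hsf hsm K L S κ' u'
  have hc : comp (comp (unitK sf sm K) (vertexOfK (unitK sf sm K) L (unitS sf sm S) κ' u')) (unitK sf sm K) =
      scaleK (legScale sf sm) (legScale sf sm) (comp (comp K (vertexOfK K L S κ' u')) K) := by
    rw [hV]
    simp only [unitK, counitK]
    rw [comp_scaleK _ _ _ _ (legScale_mul_legScale_inv hsf hsm), comp_scaleK _ _ _ _ (legScale_inv_mul_legScale hsf hsm)]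
  funext x z a b
  rcases a with α | μ
  · rcases b with β | ν
    · rw [e3K_inl_inl, e3K_inl_inl, hc, HessKerRate.scaleK_apply, legScale_inr, legScale_inr]
      ring
    · simp only [e3K_inr_right, mul_zero]
  · simp only [e3K_inr_left, mul_zero]

/-! ## §5 FAMILIES: uniform shape and one-step rate of the functional along a kernel sequence -/

/-- [folklore] **UNIFORM SHAPE ALONG A UNIFORMLY DECAYING KERNEL SEQUENCE**: `UniformDecays K C δK`, `LocStencil S Cs δ`, `0 < δ ≤ δK`,
`1 ≤ L` ⟹ every `e3K (K j) L S` is a local stencil family with the SAME constant `e3ShapeConst d C Cs δ` and rate `δ/8`. -/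
theorem locStencil_e3K_family {K : ℕ → MKer (d + 1) (Fib d)} {C δK : ℝ} (hK : UniformDecays K C δK)
    {S : Fin (d + 1) → (Fin (d + 1) → ℤ) → MKer (d + 1) (Fib d)} {Cs δ : ℝ} (hS : LocStencil S Cs δ) (hδ : 0 < δ) (hδK : δ ≤ δK)
    {L : ℕ} (hL : 1 ≤ L) (j : ℕ) : LocStencil (e3K (K j) L S) (e3ShapeConst d C Cs δ) (δ / 8) :=
  locStencil_e3K (hK j) hS hδ hδK hL

/-- [folklore] **ONE-STEP SUP RATE ALONG A CAUCHY KERNEL SEQUENCE**: `UniformDecays K C δK` and `DecayCauchy K cK θ δK` (the abstract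
shapes of the K-slot's `UnitDecayK` / `CauchyDecayK`), `LocStencil S Cs δ`, `0 < δ ≤ δK`, `1 ≤ L` ⟹
`SupBound (e3K (K (j+1)) L S κ′ u′ − e3K (K j) L S κ′ u′) (e3LipConst d C C Cs δ · cK · θ^j)` for every `j`. -/
theorem supBound_e3K_step {K : ℕ → MKer (d + 1) (Fib d)} {C cK θ δK : ℝ} (hK : UniformDecays K C δK) (hKK : DecayCauchy K cK θ δK)
    {S : Fin (d + 1) → (Fin (d + 1) → ℤ) → MKer (d + 1) (Fib d)} {Cs δ : ℝ} (hS : LocStencil S Cs δ) (hδ : 0 < δ) (hδK : δ ≤ δK)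
    {L : ℕ} (hL : 1 ≤ L) (j : ℕ) (κ' : Fin (d + 1)) (u' : Fin (d + 1) → ℤ) :
    SupBound (e3K (K (j + 1)) L S κ' u' - e3K (K j) L S κ' u') (e3LipConst d C C Cs δ * cK * θ ^ j) := by
  have h := supBound_e3K_sub (hK j) (hK (j + 1)) (hKK j 1) hS hδ hδK hL κ' u'
  intro x z a b
  refine (h x z a b).trans (le_of_eq ?_)
  ring

end Summit.QuantumFields.BalabanUV.Beta.GAN24.ThirdJetKernel

end
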